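import Mathlib
import HarnessLib
import Literature.Computability.Complexity.CNF
import Literature.Computability.Complexity.PNPWave0

/-!
# PneNP / OverlapGapAlgebra — `SearchHardWindow`: the unconditional polarity rung

Support for crux `stmt-PneNP-2460` (`Summit.PneNP.PneNP.Theses.OverlapGapAlgebra.SearchHardWindow`),
whose hardness conjunct asks that every polynomial-time `f` (input `encodingCNF` of the clause list of
`Φ : Fin m → Fin k → Fin n × Bool`, output word read as an assignment via `List.getD`) solve
`F_k(n, ⌊αn⌋)` with probability `→ 0`. Split an instance into its variable pattern
`V : Fin m → Fin k → Fin n` and its sign (polarity) pattern `S : Fin m → Fin k → Bool`. The conjunct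
is proved here UNCONDITIONALLY (no complexity hypothesis, no citation, every `k` and `α`) for all
solvers that retain little of the polarities, with free access to the variable pattern:
`shwP_card_signs_satBy` (for fixed `V`, `σ` exactly `(2^k - 1)^m` sign patterns are satisfied by
`σ`); `shwP_card_solved_le` (outputs taking `≤ N` values per `V` ⟹
`#{Φ : A Φ ⊨ Φ} ≤ N (1 - 2^{-k})^m · #instances`; `N = 2^n` is the first moment, `N = 1` a
sign-oblivious solver); `shwP_log_outputs_ge_of_success` (success `≥ ε` forces
`log N ≥ m/2^k + log ε`); `shwP_ratio_eventually_le` (asymptotic form, the registered stub) and the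
verbatim-conjunct corollaries `shwP_hardnessConjunct_of_fewSignOutputs`, `…_of_signSummary`
(`≤ B n` summaries), `…_of_bitRate` (`b n ≤ c·n` bits, `c·log 2 < α·2^{-k}`; at the window density
`α_k = 5·2^k log k/k`: every rate `c < 5 log₂ k/k`), `…_of_signOblivious` (every `k`, every `α > 0`).
Companion of the query rung (`OverlapGapAlgebraSearchHardWindowQueryRung`: what is READ; not
imported only because the farm had not built it yet); this one bounds what is RETAINED. No new definitions; axioms `propext`, `Classical.choice`, `Quot.sound`.
-/
set_option linter.dupNamespace false -- `Summit.PneNP.PneNP.…`: summit = sub-problem (D-0017)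

namespace Summit.PneNP.PneNP.Theorems

open Finset Filter
open scoped Classical

section Count

variable {m k n : ℕ}

/-- For the variable pattern `V` of one clause and a fixed assignment `σ`, exactly ONE sign vector
makes all `k` literals false (namely `j ↦ ¬σ (V j)`). [folklore] -/
theorem shwP_card_signs_unsatClause (V : Fin k → Fin n) (σ : Fin n → Bool) :
    ((univ : Finset (Fin k → Bool)).filter fun s => ∀ j, σ (V j) ≠ s j).card = 1 := by
  have h : ((univ : Finset (Fin k → Bool)).filter fun s => ∀ j, σ (V j) ≠ s j)
      = {fun j => !σ (V j)} := by
    ext s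
    simp only [mem_filter, mem_univ, true_and, mem_singleton]
    constructor
    · intro hs
      funext j
      have := hs j
      cases hσ : σ (V j) <;> cases hsj : s j <;> simp_all
    · rintro rfl j
      show σ (V j) ≠ !σ (V j)
      cases σ (V j) <;> decide
  rw [h, card_singleton]

/-- For the variable pattern `V` of one clause and a fixed `σ`, exactly `2^k - 1` of the `2^k` sign
vectors give a clause satisfied by `σ`. [folklore] -/
theorem shwP_card_signs_satClause (V : Fin k → Fin n) (σ : Fin n → Bool) :
    ((univ : Finset (Fin k → Bool)).filter fun s => ∃ j, σ (V j) = s j).card = 2 ^ k - 1 := by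
  have hsplit := Finset.card_filter_add_card_filter_not
    (s := (univ : Finset (Fin k → Bool))) (fun s => ∃ j, σ (V j) = s j)
  have hneg : ((univ : Finset (Fin k → Bool)).filter fun s => ¬ ∃ j, σ (V j) = s j)
      = univ.filter fun s => ∀ j, σ (V j) ≠ s j := by
    congr 1; ext s; simp
  rw [hneg, shwP_card_signs_unsatClause, card_univ, Fintype.card_fun, Fintype.card_fin,
    Fintype.card_bool] at hsplit
  omega

/-- For the variable pattern `V` of a whole instance and a fixed `σ`, exactly `(2^k - 1)^m` of the
sign patterns are satisfied by `σ`: the good sign patterns form a box. [folklore] -/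
theorem shwP_card_signs_satBy (V : Fin m → Fin k → Fin n) (σ : Fin n → Bool) :
    ((univ : Finset (Fin m → Fin k → Bool)).filter fun S => ∀ i, ∃ j, σ (V i j) = S i j).card
      = (2 ^ k - 1) ^ m := by
  have h : ((univ : Finset (Fin m → Fin k → Bool)).filter fun S => ∀ i, ∃ j, σ (V i j) = S i j)
      = Fintype.piFinset fun i =>
          (univ : Finset (Fin k → Bool)).filter fun s => ∃ j, σ (V i j) = s j := by
    ext S
    simp [Fintype.mem_piFinset]
  rw [h, Fintype.card_piFinset]
  simp_rw [shwP_card_signs_satClause]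
  rw [prod_const, card_univ, Fintype.card_fin]

/-- **Polarity rung, one variable pattern.** Fix the variable pattern `V` and let `g` map sign
patterns to assignments (a solver restricted to the instances with variable pattern `V`). The sign
patterns solved by `g` number at most `#(range g) · (2^k - 1)^m`. -/
theorem shwP_card_solved_signs_le (V : Fin m → Fin k → Fin n)
    (g : (Fin m → Fin k → Bool) → (Fin n → Bool)) :
    ((univ : Finset (Fin m → Fin k → Bool)).filter fun S => ∀ i, ∃ j, g S (V i j) = S i j).card
      ≤ (univ.image g).card * (2 ^ k - 1) ^ m := by
  have hsub : ((univ : Finset (Fin m → Fin k → Bool)).filter fun S => ∀ i, ∃ j, g S (V i j) = S i j)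
      ⊆ (univ.image g).biUnion fun σ =>
          (univ : Finset (Fin m → Fin k → Bool)).filter fun S => ∀ i, ∃ j, σ (V i j) = S i j := by
    intro S hS
    simp only [mem_filter, mem_univ, true_and] at hS
    simp only [mem_biUnion, mem_image, mem_univ, true_and, mem_filter]
    exact ⟨g S, ⟨S, rfl⟩, hS⟩
  calc _ ≤ _ := card_le_card hsub
    _ ≤ ∑ σ ∈ univ.image g, ((univ : Finset (Fin m → Fin k → Bool)).filter fun S =>
          ∀ i, ∃ j, σ (V i j) = S i j).card := card_biUnion_le
    _ = (univ.image g).card * (2 ^ k - 1) ^ m := by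
        simp only [shwP_card_signs_satBy, sum_const, smul_eq_mul]

/-- **Polarity rung, counting form.** If for every variable pattern `V` the solver's output takes at
most `N` values as the sign pattern varies, then
`#{Φ : A Φ ⊨ Φ} ≤ #(variable patterns) · N · (2^k - 1)^m`. -/
theorem shwP_card_solved_le_nat
    (A : (Fin m → Fin k → Fin n × Bool) → (Fin n → Bool)) (N : ℕ)
    (hN : ∀ V : Fin m → Fin k → Fin n,
      (univ.image fun S : Fin m → Fin k → Bool => A fun i j => (V i j, S i j)).card ≤ N) :
    ((univ : Finset (Fin m → Fin k → Fin n × Bool)).filter fun Φ =>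
        ∀ i, ∃ j, A Φ (Φ i j).1 = (Φ i j).2).card
      ≤ Fintype.card (Fin m → Fin k → Fin n) * (N * (2 ^ k - 1) ^ m) := by
  set G : Finset (Fin m → Fin k → Fin n × Bool) :=
    univ.filter fun Φ => ∀ i, ∃ j, A Φ (Φ i j).1 = (Φ i j).2 with hG
  set vars : (Fin m → Fin k → Fin n × Bool) → (Fin m → Fin k → Fin n) :=
    fun Φ i j => (Φ i j).1 with hvars
  -- the fibre of `G` over `V` is the image of the solved sign patterns under `S ↦ (V, S)`
  have hV : ∀ V : Fin m → Fin k → Fin n,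
      (G.filter fun Φ => vars Φ = V).card ≤ N * (2 ^ k - 1) ^ m := by
    intro V
    have hfiber : (G.filter fun Φ => vars Φ = V)
        = ((univ : Finset (Fin m → Fin k → Bool)).filter fun S =>
            ∀ i, ∃ j, A (fun i j => (V i j, S i j)) (V i j) = S i j).image
              fun S i j => (V i j, S i j) := by
      ext Φ
      simp only [hG, hvars, mem_filter, mem_univ, true_and, mem_image]
      constructor
      · rintro ⟨hP, rfl⟩
        refine ⟨fun i j => (Φ i j).2, ?_, ?_⟩
        · simpa using hP
        · funext i j; simp
      · rintro ⟨S, hS, rfl⟩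
        exact ⟨by simpa using hS, rfl⟩
    have hinj : Function.Injective
        fun (S : Fin m → Fin k → Bool) (i : Fin m) (j : Fin k) => (V i j, S i j) := by
      intro S S' h
      funext i j
      simpa using congr_fun (congr_fun h i) j
    rw [hfiber, card_image_of_injective _ hinj]
    calc _ ≤ (univ.image fun S : Fin m → Fin k → Bool => A fun i j => (V i j, S i j)).card
              * (2 ^ k - 1) ^ m :=
          shwP_card_solved_signs_le V (fun S => A fun i j => (V i j, S i j))
      _ ≤ N * (2 ^ k - 1) ^ m := Nat.mul_le_mul_right _ (hN V)
  calc G.card = ∑ V : Fin m → Fin k → Fin n, (G.filter fun Φ => vars Φ = V).card :=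
        card_eq_sum_card_fiberwise (f := vars) (t := univ) fun _ _ => mem_univ _
    _ ≤ ∑ _V : Fin m → Fin k → Fin n, N * (2 ^ k - 1) ^ m := sum_le_sum fun V _ => hV V
    _ = Fintype.card (Fin m → Fin k → Fin n) * (N * (2 ^ k - 1) ^ m) := by
        rw [sum_const, card_univ, smul_eq_mul]

/-- **Polarity rung, probability form.** Under the same hypothesis the solved fraction is at most
`N · (1 - 2^{-k})^m`: `#{Φ : A Φ ⊨ Φ} ≤ N (1 - 2^{-k})^m · #instances`. (`N = 2^n`, the trivial bound,
is the first-moment method; `N = 1` is a sign-oblivious solver.) -/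
theorem shwP_card_solved_le
    (A : (Fin m → Fin k → Fin n × Bool) → (Fin n → Bool)) (N : ℕ)
    (hN : ∀ V : Fin m → Fin k → Fin n,
      (univ.image fun S : Fin m → Fin k → Bool => A fun i j => (V i j, S i j)).card ≤ N) :
    (((univ : Finset (Fin m → Fin k → Fin n × Bool)).filter fun Φ =>
        ∀ i, ∃ j, A Φ (Φ i j).1 = (Φ i j).2).card : ℝ)
      ≤ N * (1 - (1 / 2 : ℝ) ^ k) ^ m * Fintype.card (Fin m → Fin k → Fin n × Bool) := by
  have h := (Nat.cast_le (α := ℝ)).2 (shwP_card_solved_le_nat A N hN)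
  have h1 : (1 : ℕ) ≤ 2 ^ k := Nat.one_le_two_pow
  push_cast [Nat.cast_sub h1] at h
  have hV : (Fintype.card (Fin m → Fin k → Fin n) : ℝ) = ((n : ℝ) ^ k) ^ m := by
    rw [Fintype.card_fun, Fintype.card_fun, Fintype.card_fin, Fintype.card_fin, Fintype.card_fin]
    push_cast; ring
  have hI : (Fintype.card (Fin m → Fin k → Fin n × Bool) : ℝ) = ((2 * n : ℝ) ^ k) ^ m := by
    rw [Fintype.card_fun, Fintype.card_fun, Fintype.card_prod, Fintype.card_fin, Fintype.card_fin,
      Fintype.card_bool, Fintype.card_fin]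
    push_cast; ring
  rw [hV] at h; rw [hI]; refine h.trans (le_of_eq ?_)
  have key : (2 : ℝ) ^ k - 1 = (1 - (1 / 2 : ℝ) ^ k) * 2 ^ k := by
    rw [sub_mul, one_mul, one_div, inv_pow, inv_mul_cancel₀ (by positivity : (2 : ℝ) ^ k ≠ 0)]
  rw [key]; simp only [mul_pow]; ring

/-- **Quantitative contrapositive / information lower bound.** If such a solver succeeds on at
least an `ε`-fraction of the instances (`ε > 0`, `n ≥ 1`), then `ε ≤ N (1 - 2^{-k})^m`, hence
`log N ≥ m / 2^k + log ε`: success with probability `ε` needs at least `m/2^k - log(1/ε)` nats of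
polarity information in the output, uniformly in `n`. -/
theorem shwP_log_outputs_ge_of_success (hn : 1 ≤ n)
    (A : (Fin m → Fin k → Fin n × Bool) → (Fin n → Bool)) (N : ℕ)
    (hN : ∀ V : Fin m → Fin k → Fin n,
      (univ.image fun S : Fin m → Fin k → Bool => A fun i j => (V i j, S i j)).card ≤ N)
    (ε : ℝ) (hε : 0 < ε)
    (hsucc : ε * Fintype.card (Fin m → Fin k → Fin n × Bool) ≤
      ((univ : Finset (Fin m → Fin k → Fin n × Bool)).filter fun Φ =>
        ∀ i, ∃ j, A Φ (Φ i j).1 = (Φ i j).2).card) :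
    ε ≤ N * (1 - (1 / 2 : ℝ) ^ k) ^ m ∧ (m : ℝ) / 2 ^ k + Real.log ε ≤ Real.log N := by
  have hcard : (0 : ℝ) < Fintype.card (Fin m → Fin k → Fin n × Bool) := by
    haveI : Nonempty (Fin n × Bool) := ⟨(⟨0, hn⟩, false)⟩
    exact_mod_cast Fintype.card_pos
  have hεle : ε ≤ N * (1 - (1 / 2 : ℝ) ^ k) ^ m :=
    le_of_mul_le_mul_right (hsucc.trans (shwP_card_solved_le A N hN)) hcard
  refine ⟨hεle, ?_⟩
  set p : ℝ := (1 / 2 : ℝ) ^ k with hp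
  have hp0 : 0 < p := by positivity
  have hp1 : p ≤ 1 := pow_le_one₀ (by norm_num) (by norm_num)
  have hexp : (1 - p) ^ m ≤ Real.exp (-(p * m)) := by
    calc (1 - p) ^ m ≤ (Real.exp (-p)) ^ m :=
          pow_le_pow_left₀ (by linarith) (by linarith [Real.one_sub_le_exp_neg p]) m
      _ = Real.exp (-(p * m)) := by rw [← Real.exp_nat_mul]; ring_nf
  have hNpos : (0 : ℝ) < N := by
    rcases (Nat.cast_nonneg (α := ℝ) N).eq_or_lt with h0 | h0
    · rw [← h0, zero_mul] at hεle; exact absurd hεle (not_le.2 hε)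
    · exact h0
  have hle : ε ≤ N * Real.exp (-(p * m)) :=
    hεle.trans (mul_le_mul_of_nonneg_left hexp hNpos.le)
  have hlog : Real.log ε ≤ Real.log N + -(p * m) := by
    have := Real.log_le_log hε hle
    rwa [Real.log_mul hNpos.ne' (Real.exp_pos _).ne', Real.log_exp] at this
  have hpm : p * m = (m : ℝ) / 2 ^ k := by rw [hp, one_div, inv_pow, div_eq_inv_mul]
  linarith

end Count

section Asymptotic

open Literature.Computability.Complexity

/-- **Polarity rung, asymptotic form (abstract solvers, any `k`, any `α`).** A family of solvers
`A n m` whose outputs take at most `N n` values on each variable pattern of `F_k(n, ⌊αn⌋)`, with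
`N n · (1 - 2^{-k})^{⌊αn⌋} → 0`, solves `F_k(n, ⌊αn⌋)` with probability `→ 0`. -/
theorem shwP_ratio_eventually_le (k : ℕ) (α : ℝ) (N : ℕ → ℕ)
    (hN : Tendsto (fun n : ℕ => (N n : ℝ) * (1 - (1 / 2 : ℝ) ^ k) ^ ⌊α * n⌋₊) atTop (nhds 0))
    (A : (n m : ℕ) → (Fin m → Fin k → Fin n × Bool) → (Fin n → Bool))
    (hA : ∀ᶠ n : ℕ in atTop, ∀ m : ℕ, m = ⌊α * n⌋₊ → ∀ V : Fin m → Fin k → Fin n,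
      (univ.image fun S : Fin m → Fin k → Bool => A n m fun i j => (V i j, S i j)).card ≤ N n)
    (ε : ℝ) (hε : 0 < ε) :
    ∀ᶠ n : ℕ in atTop, ∀ m : ℕ, m = ⌊α * n⌋₊ →
      (((univ : Finset (Fin m → Fin k → Fin n × Bool)).filter fun Φ =>
          ∀ i, ∃ j, A n m Φ (Φ i j).1 = (Φ i j).2).card : ℝ)
        / Fintype.card (Fin m → Fin k → Fin n × Bool) ≤ ε := by
  filter_upwards [hA, hN.eventually (ge_mem_nhds hε)] with n hn hsmall
  intro m hm
  have h := shwP_card_solved_le (A n m) (N n) (hn m hm)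
  rcases (Nat.cast_nonneg (α := ℝ) (Fintype.card (Fin m → Fin k → Fin n × Bool))).eq_or_lt
    with h0 | hpos
  · rw [← h0, div_zero]; exact hε.le
  · rw [div_le_iff₀ hpos]
    subst hm
    exact h.trans (mul_le_mul_of_nonneg_right hsmall (Nat.cast_nonneg _))

/-- **Polarity rung for the crux's hardness conjunct (verbatim shape).** For ANY
`f : List Bool → List Bool` (no complexity hypothesis): if, eventually in `n`, for every variable
pattern `V` of `F_k(n, ⌊αn⌋)` the decoded assignment `v ↦ (f ⌜(V, S)⌝).getD v false` takes at most
`N n` values as the sign pattern `S` varies, and `N n · (1 - 2^{-k})^{⌊αn⌋} → 0`, then `f` satisfies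
the hardness conjunct of `SearchHardWindow` at `(k, α)`: its success ratio is eventually `≤ ε` for
every `ε > 0`. -/
theorem shwP_hardnessConjunct_of_fewSignOutputs (k : ℕ) (α : ℝ) (f : List Bool → List Bool)
    (N : ℕ → ℕ)
    (hN : Tendsto (fun n : ℕ => (N n : ℝ) * (1 - (1 / 2 : ℝ) ^ k) ^ ⌊α * n⌋₊) atTop (nhds 0))
    (hf : ∀ᶠ n : ℕ in atTop, ∀ m : ℕ, m = ⌊α * n⌋₊ → ∀ V : Fin m → Fin k → Fin n,
      (univ.image fun S : Fin m → Fin k → Bool => fun v : Fin n =>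
        (f (encodingCNF.encode (List.ofFn fun a => List.ofFn fun b =>
          (((V a b : Fin n) : ℕ), S a b)))).getD v false).card ≤ N n) :
    ∀ ε : ℝ, 0 < ε → ∀ᶠ n : ℕ in Filter.atTop, ∀ m : ℕ, m = ⌊α * n⌋₊ →
      ((Finset.univ.filter fun Φ : Fin m → Fin k → Fin n × Bool => ∀ i, ∃ j,
          (f (Literature.Computability.Complexity.encodingCNF.encode (List.ofFn fun a =>
            List.ofFn fun b => (((Φ a b).1 : ℕ), (Φ a b).2)))).getD (Φ i j).1 false =
              (Φ i j).2).card : ℝ) / Fintype.card (Fin m → Fin k → Fin n × Bool) ≤ ε := by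
  intro ε hε
  exact shwP_ratio_eventually_le k α N hN
    (fun n m Φ v => (f (encodingCNF.encode (List.ofFn fun a => List.ofFn fun b =>
      (((Φ a b).1 : ℕ), (Φ a b).2)))).getD v false) hf ε hε

/-- **`B n` polarity summaries.** If, eventually in `n`, for every variable pattern `V` the decoded
output of `f` depends on the sign pattern only through a summary `h` with at most `B n` values
(e.g. `B n = 2^{b n}`: the solver extracts `b n` bits from the polarities, with free access to the
variable pattern), and `B n · (1 - 2^{-k})^{⌊αn⌋} → 0`, then `f` satisfies the hardness conjunct of
`SearchHardWindow` at `(k, α)`. -/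
theorem shwP_hardnessConjunct_of_signSummary (k : ℕ) (α : ℝ) (f : List Bool → List Bool)
    (B : ℕ → ℕ)
    (hB : Tendsto (fun n : ℕ => (B n : ℝ) * (1 - (1 / 2 : ℝ) ^ k) ^ ⌊α * n⌋₊) atTop (nhds 0))
    (hf : ∀ᶠ n : ℕ in atTop, ∀ m : ℕ, m = ⌊α * n⌋₊ → ∀ V : Fin m → Fin k → Fin n,
      ∃ h : (Fin m → Fin k → Bool) → Fin (B n), ∀ S S' : Fin m → Fin k → Bool, h S = h S' →
        ∀ v : Fin n,
          (f (encodingCNF.encode (List.ofFn fun a => List.ofFn fun b =>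
              (((V a b : Fin n) : ℕ), S a b)))).getD v false
            = (f (encodingCNF.encode (List.ofFn fun a => List.ofFn fun b =>
              (((V a b : Fin n) : ℕ), S' a b)))).getD v false) :
    ∀ ε : ℝ, 0 < ε → ∀ᶠ n : ℕ in Filter.atTop, ∀ m : ℕ, m = ⌊α * n⌋₊ →
      ((Finset.univ.filter fun Φ : Fin m → Fin k → Fin n × Bool => ∀ i, ∃ j,
          (f (Literature.Computability.Complexity.encodingCNF.encode (List.ofFn fun a =>
            List.ofFn fun b => (((Φ a b).1 : ℕ), (Φ a b).2)))).getD (Φ i j).1 false =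
              (Φ i j).2).card : ℝ) / Fintype.card (Fin m → Fin k → Fin n × Bool) ≤ ε := by
  refine shwP_hardnessConjunct_of_fewSignOutputs k α f B hB (hf.mono fun n hn m hm V => ?_)
  obtain ⟨h, hh⟩ := hn m hm V
  set F : (Fin m → Fin k → Bool) → (Fin n → Bool) := fun S v =>
    (f (encodingCNF.encode (List.ofFn fun a => List.ofFn fun b =>
      (((V a b : Fin n) : ℕ), S a b)))).getD v false with hF
  -- `F` factors through `h`, so its image is no larger than the image of `h`
  have hfac : univ.image F ⊆ (univ.image h).image fun β =>
      F (if hβ : ∃ S, h S = β then Classical.choose hβ else fun _ _ => false) := by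
    intro σ hσ
    obtain ⟨S, -, rfl⟩ := mem_image.1 hσ
    refine mem_image.2 ⟨h S, mem_image_of_mem h (mem_univ S), ?_⟩
    have hex : ∃ S', h S' = h S := ⟨S, rfl⟩
    rw [dif_pos hex]
    exact funext fun v => hh _ _ (Classical.choose_spec hex) v
  calc (univ.image F).card
        ≤ ((univ.image h).image fun β =>
            F (if hβ : ∃ S, h S = β then Classical.choose hβ else fun _ _ => false)).card :=
          card_le_card hfac
    _ ≤ (univ.image h).card := card_image_le
    _ ≤ (univ : Finset (Fin (B n))).card := card_le_card (subset_univ _)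
    _ = B n := by rw [card_univ, Fintype.card_fin]

/-- **Bit-rate criterion.** If `b n ≤ c·n` eventually and `c · log 2 < α · 2^{-k}`, then
`2^{b n} · (1 - 2^{-k})^{⌊αn⌋} → 0` (at the window density `α_k = 5·2^k log k/k`: `c < 5 log₂ k/k`). -/
theorem shwP_tendsto_bits_mul_pow (k : ℕ) (α c : ℝ) (hc : c * Real.log 2 < α * (1 / 2 : ℝ) ^ k)
    (b : ℕ → ℕ) (hb : ∀ᶠ n : ℕ in atTop, (b n : ℝ) ≤ c * n) :
    Tendsto (fun n : ℕ => ((2 ^ b n : ℕ) : ℝ) * (1 - (1 / 2 : ℝ) ^ k) ^ ⌊α * n⌋₊) atTop (nhds 0) := by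
  set p : ℝ := (1 / 2 : ℝ) ^ k with hp
  have hp0 : 0 < p := by positivity
  have hp1 : p ≤ 1 := pow_le_one₀ (by norm_num) (by norm_num)
  set δ : ℝ := α * p - c * Real.log 2 with hδ
  have hδ0 : 0 < δ := by rw [hδ]; linarith
  have hlog2 : 0 ≤ Real.log 2 := Real.log_nonneg (by norm_num)
  have hbound : ∀ᶠ n : ℕ in atTop,
      ((2 ^ b n : ℕ) : ℝ) * (1 - p) ^ ⌊α * n⌋₊ ≤ Real.exp p * Real.exp (-(δ * n)) := by
    filter_upwards [hb] with n hn
    have h1 : ((2 ^ b n : ℕ) : ℝ) ≤ Real.exp (c * n * Real.log 2) := by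
      have h2 : ((2 ^ b n : ℕ) : ℝ) = Real.exp (b n * Real.log 2) := by
        push_cast; rw [← Real.rpow_natCast, Real.rpow_def_of_pos (by norm_num : (0 : ℝ) < 2), mul_comm]
      exact h2 ▸ Real.exp_le_exp.2 (mul_le_mul_of_nonneg_right hn hlog2)
    have h3 : (1 - p) ^ ⌊α * n⌋₊ ≤ Real.exp (-(p * ⌊α * n⌋₊)) := by
      calc (1 - p) ^ ⌊α * n⌋₊ ≤ (Real.exp (-p)) ^ ⌊α * n⌋₊ :=
            pow_le_pow_left₀ (by linarith) (by linarith [Real.one_sub_le_exp_neg p]) _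
        _ = Real.exp (-(p * ⌊α * n⌋₊)) := by rw [← Real.exp_nat_mul]; ring_nf
    have h4 : Real.exp (-(p * ⌊α * n⌋₊)) ≤ Real.exp (-(p * (α * n - 1))) :=
      Real.exp_le_exp.2 (neg_le_neg (mul_le_mul_of_nonneg_left
        (by linarith [Nat.lt_floor_add_one (α * n)]) hp0.le))
    calc ((2 ^ b n : ℕ) : ℝ) * (1 - p) ^ ⌊α * n⌋₊
          ≤ Real.exp (c * n * Real.log 2) * Real.exp (-(p * (α * n - 1))) :=
            mul_le_mul h1 (h3.trans h4) (by positivity) (by positivity)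
      _ = Real.exp p * Real.exp (-(δ * n)) := by
            rw [← Real.exp_add, ← Real.exp_add, hδ]; ring_nf
  have hlim : Tendsto (fun n : ℕ => Real.exp p * Real.exp (-(δ * n))) atTop (nhds 0) :=
    mul_zero (Real.exp p) ▸ Tendsto.const_mul _ (Real.tendsto_exp_atBot.comp
      (tendsto_neg_atTop_atBot.comp (Tendsto.const_mul_atTop hδ0 tendsto_natCast_atTop_atTop)))
  refine squeeze_zero' (Eventually.of_forall fun n => ?_) hbound hlim
  exact mul_nonneg (Nat.cast_nonneg _) (pow_nonneg (by linarith) _)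

/-- **Bit-rate corollary.** If, eventually in `n`, for every variable pattern the decoded output of
`f` depends on the sign pattern only through `b n ≤ c·n` bits, where `c · log 2 < α · 2^{-k}`
(`c < 5 log₂ k / k` at the window density), then `f` satisfies the hardness conjunct of
`SearchHardWindow` at `(k, α)` — for every `k`, unconditionally. -/
theorem shwP_hardnessConjunct_of_bitRate (k : ℕ) (α c : ℝ) (hc : c * Real.log 2 < α * (1 / 2 : ℝ) ^ k)
    (f : List Bool → List Bool) (b : ℕ → ℕ) (hb : ∀ᶠ n : ℕ in atTop, (b n : ℝ) ≤ c * n)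
    (hf : ∀ᶠ n : ℕ in atTop, ∀ m : ℕ, m = ⌊α * n⌋₊ → ∀ V : Fin m → Fin k → Fin n,
      ∃ h : (Fin m → Fin k → Bool) → Fin (2 ^ b n), ∀ S S' : Fin m → Fin k → Bool, h S = h S' →
        ∀ v : Fin n,
          (f (encodingCNF.encode (List.ofFn fun a => List.ofFn fun b =>
              (((V a b : Fin n) : ℕ), S a b)))).getD v false
            = (f (encodingCNF.encode (List.ofFn fun a => List.ofFn fun b =>
              (((V a b : Fin n) : ℕ), S' a b)))).getD v false) :
    ∀ ε : ℝ, 0 < ε → ∀ᶠ n : ℕ in Filter.atTop, ∀ m : ℕ, m = ⌊α * n⌋₊ →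
      ((Finset.univ.filter fun Φ : Fin m → Fin k → Fin n × Bool => ∀ i, ∃ j,
          (f (Literature.Computability.Complexity.encodingCNF.encode (List.ofFn fun a =>
            List.ofFn fun b => (((Φ a b).1 : ℕ), (Φ a b).2)))).getD (Φ i j).1 false =
              (Φ i j).2).card : ℝ) / Fintype.card (Fin m → Fin k → Fin n × Bool) ≤ ε :=
  shwP_hardnessConjunct_of_signSummary k α f (fun n => 2 ^ b n)
    (shwP_tendsto_bits_mul_pow k α c hc b hb) hf

/-- **Sign-oblivious corollary.** If `α > 0` and, eventually in `n`, the decoded assignment of `f`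
does not depend on the polarities at all (it may depend arbitrarily on the variable pattern: any
hypergraph-only heuristic), then `f` satisfies the hardness conjunct of `SearchHardWindow` at
`(k, α)`, for every `k` (its success probability is `≤ (1 - 2^{-k})^{⌊αn⌋} → 0`). -/
theorem shwP_hardnessConjunct_of_signOblivious (k : ℕ) (α : ℝ) (hα : 0 < α)
    (f : List Bool → List Bool)
    (hf : ∀ᶠ n : ℕ in atTop, ∀ m : ℕ, m = ⌊α * n⌋₊ → ∀ V : Fin m → Fin k → Fin n,
      ∀ S S' : Fin m → Fin k → Bool, ∀ v : Fin n,
        (f (encodingCNF.encode (List.ofFn fun a => List.ofFn fun b =>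
            (((V a b : Fin n) : ℕ), S a b)))).getD v false
          = (f (encodingCNF.encode (List.ofFn fun a => List.ofFn fun b =>
            (((V a b : Fin n) : ℕ), S' a b)))).getD v false) :
    ∀ ε : ℝ, 0 < ε → ∀ᶠ n : ℕ in Filter.atTop, ∀ m : ℕ, m = ⌊α * n⌋₊ →
      ((Finset.univ.filter fun Φ : Fin m → Fin k → Fin n × Bool => ∀ i, ∃ j,
          (f (Literature.Computability.Complexity.encodingCNF.encode (List.ofFn fun a =>
            List.ofFn fun b => (((Φ a b).1 : ℕ), (Φ a b).2)))).getD (Φ i j).1 false =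
              (Φ i j).2).card : ℝ) / Fintype.card (Fin m → Fin k → Fin n × Bool) ≤ ε := by
  have hs : Tendsto (fun n : ℕ => ⌊α * n⌋₊) atTop atTop :=
    tendsto_nat_floor_atTop.comp (Tendsto.const_mul_atTop hα tendsto_natCast_atTop_atTop)
  refine shwP_hardnessConjunct_of_fewSignOutputs k α f (fun _ => 1) ?_
    (hf.mono fun n hn m hm V => ?_)
  · have h0 : (0 : ℝ) ≤ 1 - (1 / 2 : ℝ) ^ k := sub_nonneg.2 (pow_le_one₀ (by norm_num) (by norm_num))
    have h1 : Tendsto (fun n : ℕ => (1 - (1 / 2 : ℝ) ^ k) ^ ⌊α * n⌋₊) atTop (nhds 0) :=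
      (tendsto_pow_atTop_nhds_zero_of_lt_one h0 (sub_lt_self _ (by positivity))).comp hs
    simpa using h1
  · refine Finset.card_le_one.2 fun σ hσ τ hτ => ?_
    obtain ⟨S, -, rfl⟩ := mem_image.1 hσ
    obtain ⟨S', -, rfl⟩ := mem_image.1 hτ
    exact funext fun v => hn m hm V S S' v

end Asymptotic

end Summit.PneNP.PneNP.Theorems
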